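import Mathlib
import Literature.Analysis.PDE.ConservationLawWeakStrong

/-!
# Weak solutions of conservation laws tested against Lipschitz test functions

Sibling proof file of `ConservationLawWeakStrong.lean` (Dafermos, *Hyperbolic Conservation Laws in
Continuum Physics*, 1st ed. 2000 [Dafermos2000], §4.1 (4.1.6) and the proof of Thm 5.2.1,
PDF pp. 111, 126–127 of the held scan).

Dafermos formulates weak solutions (4.1.6) with *Lipschitz* test functions of compact support in
`ℝ^m × [0,T)`; the vendored `IsWeakSolution` uses `C¹` test functions (`IsTestFunction`).  The proof
of Theorem 5.2.1 tests (4.1.6) "using components of the Lipschitz continuous vector field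
`ψ Dη(Ū)` as test function" (p. 127).  This file supplies that step for the `C¹` formulation:

* `slab T = (0,T) × ℝ^m`, the directions `dirT = (1,0)`, `dirX α = (0,e_α)`, and the dictionary
  `testTimeDeriv φ t x = lineDeriv ℝ φ (t,x) dirT`, `testSpaceDeriv φ α t x = lineDeriv ℝ φ (t,x) (dirX α)`;
* `IsWeakSolution.slab_identity` — the weak identity (4.1.6) written as ONE integral over the slab
  (Fubini) for `C¹` test functions, when `U` and the `G_α(U)` are bounded on the slab;
* `IsWeakSolution.lipschitz_test` — **(4.1.6) for every Lipschitz test function with compact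
  support vanishing for `t ≥ T' (< T)`**, the derivatives being the (a.e. defined) line derivatives:
  proved by mollification `Φ_k = ρ_k ⋆ Φ` with Mathlib's normed bump functions, the identity
  `D(ρ ⋆ Φ) v = ρ ⋆ (∂_v Φ)` (integration by parts for Lipschitz functions,
  `LipschitzWith.integral_lineDeriv_mul_eq`), a.e. convergence `ρ_k ⋆ ∂_vΦ → ∂_vΦ`
  (Lebesgue differentiation, `ContDiffBump.ae_convolution_tendsto_right_of_locallyIntegrable`) and
  dominated convergence.

No new definitions of notions; no named facts.
-/

noncomputable section

open MeasureTheory Set Filter Topology Metric Function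
open scoped BigOperators Convolution NNReal ContDiff

namespace Literature.Analysis.PDE

namespace ConservationLaw

variable {m n : ℕ}

/-! ### Space–time, the slab, directions -/

/-- Lebesgue measure on space–time `ℝ × ℝ^m` is an additive Haar measure (Mathlib's instance for
`Measure.prod`, made available for `volume`, which type-class search does not unfold; used through
`haveI` inside proofs, not registered as an instance). [folklore] -/
theorem isAddHaarMeasure_volume_spaceTime :
    (volume : Measure (ℝ × EuclideanSpace ℝ (Fin m))).IsAddHaarMeasure := by
  rw [show (volume : Measure (ℝ × EuclideanSpace ℝ (Fin m))) = (volume : Measure ℝ).prod volume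
    from rfl]
  infer_instance

/-- The open slab `(0,T) × ℝ^m` of space–time (time first). [folklore] -/
def slab (m : ℕ) (T : ℝ) : Set (ℝ × EuclideanSpace ℝ (Fin m)) := Set.Ioo 0 T ×ˢ Set.univ

/-- The slab is measurable. [folklore] -/
theorem measurableSet_slab (T : ℝ) : MeasurableSet (slab m T) :=
  measurableSet_Ioo.prod MeasurableSet.univ

/-- The slab is open. [folklore] -/
theorem isOpen_slab (T : ℝ) : IsOpen (slab m T) := isOpen_Ioo.prod isOpen_univ

/-- Membership in the slab is the time constraint `0 < t < T`. [folklore] -/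
theorem mem_slab {T : ℝ} {p : ℝ × EuclideanSpace ℝ (Fin m)} : p ∈ slab m T ↔ p.1 ∈ Set.Ioo 0 T := by
  simp [slab, Set.mem_prod]

/-- Lebesgue measure restricted to the slab is the product of `dt|_(0,T)` and `dx`. [folklore] -/
theorem volume_restrict_slab (T : ℝ) :
    (volume : Measure (ℝ × EuclideanSpace ℝ (Fin m))).restrict (slab m T)
      = ((volume : Measure ℝ).restrict (Set.Ioo 0 T)).prod volume := by
  rw [show (volume : Measure (ℝ × EuclideanSpace ℝ (Fin m))) = (volume : Measure ℝ).prod volume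
    from rfl, slab, ← Measure.restrict_univ (μ := (volume : Measure (EuclideanSpace ℝ (Fin m)))),
    Measure.prod_restrict, Measure.restrict_univ]

/-- Fubini on the slab: an iterated `∫_{t∈(0,T)} ∫_x` of an integrand integrable on the slab is the
slab integral. [folklore] -/
theorem integral_slab_eq_iterated {F' : Type*} [NormedAddCommGroup F'] [NormedSpace ℝ F']
    {T : ℝ} {F : ℝ × EuclideanSpace ℝ (Fin m) → F'} (hF : IntegrableOn F (slab m T)) :
    ∫ p in slab m T, F p = ∫ t in Set.Ioo 0 T, ∫ x, F (t, x) := by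
  haveI := isAddHaarMeasure_volume_spaceTime (m := m)
  have hF' : Integrable F (((volume : Measure ℝ).restrict (Set.Ioo 0 T)).prod volume) := by
    rw [← volume_restrict_slab]; exact hF
  rw [show (∫ p in slab m T, F p)
      = ∫ p, F p ∂(((volume : Measure ℝ).restrict (Set.Ioo 0 T)).prod volume) by
    rw [volume_restrict_slab]]
  exact integral_prod F hF'

/-- The time direction `(1,0)` of space–time. [folklore] -/
def dirT (m : ℕ) : ℝ × EuclideanSpace ℝ (Fin m) := (1, 0)

/-- The `α`-th space direction `(0,e_α)` of space–time. [folklore] -/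
def dirX (α : Fin m) : ℝ × EuclideanSpace ℝ (Fin m) := (0, EuclideanSpace.single α (1 : ℝ))

/-- `∂ₜφ` of `ConservationLawWeakStrong` is the line derivative in the time direction. [folklore] -/
theorem testTimeDeriv_eq_lineDeriv (φ : ℝ × EuclideanSpace ℝ (Fin m) → ℝ) (t : ℝ)
    (x : EuclideanSpace ℝ (Fin m)) : testTimeDeriv φ t x = lineDeriv ℝ φ (t, x) (dirT m) := by
  unfold testTimeDeriv lineDeriv dirT
  set g : ℝ → ℝ := fun r => φ (r, x) with hg
  have : (fun s : ℝ => φ ((t, x) + s • ((1 : ℝ), (0 : EuclideanSpace ℝ (Fin m)))))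
      = fun s : ℝ => g (t + s) := by
    ext s; simp [hg]
  rw [this, deriv_comp_const_add, add_zero]

/-- `∂_αφ` of `ConservationLawWeakStrong` is the line derivative in the direction `(0,e_α)`.
[folklore] -/
theorem testSpaceDeriv_eq_lineDeriv (φ : ℝ × EuclideanSpace ℝ (Fin m) → ℝ) (α : Fin m) (t : ℝ)
    (x : EuclideanSpace ℝ (Fin m)) : testSpaceDeriv φ α t x = lineDeriv ℝ φ (t, x) (dirX α) := by
  unfold testSpaceDeriv lineDeriv dirX
  congr 1; ext s; simp

/-! ### The weak identity as a slab integral -/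

section slabIdentity

variable {O : Set (EuclideanSpace ℝ (Fin n))}
  {G : Fin m → EuclideanSpace ℝ (Fin n) → EuclideanSpace ℝ (Fin n)} {T : ℝ}
  {U : ℝ → EuclideanSpace ℝ (Fin m) → EuclideanSpace ℝ (Fin n)}
  {U₀ : EuclideanSpace ℝ (Fin m) → EuclideanSpace ℝ (Fin n)}

/-- A scalar continuous compactly supported weight times a bounded a.e.-strongly-measurable field is
integrable on the slab. [folklore] -/
theorem integrableOn_slab_smul {T : ℝ} {c : ℝ × EuclideanSpace ℝ (Fin m) → ℝ}
    {u : ℝ × EuclideanSpace ℝ (Fin m) → EuclideanSpace ℝ (Fin n)}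
    (hc : Continuous c) (hcs : HasCompactSupport c)
    (hu : AEStronglyMeasurable u (volume.restrict (slab m T)))
    {M : ℝ} (hM : ∀ p ∈ slab m T, ‖u p‖ ≤ M) :
    IntegrableOn (fun p => c p • u p) (slab m T) := by
  have h1 : Integrable c (volume.restrict (slab m T)) :=
    (hc.integrable_of_hasCompactSupport hcs).integrableOn
  have h2 : ∀ᵐ p ∂(volume.restrict (slab m T)), ‖u p‖ ≤ M := by
    rw [ae_restrict_iff' (measurableSet_slab T)]
    exact Eventually.of_forall hM
  exact h1.smul_bdd M hu h2

/-- Slab form of (4.1.6) for `C¹` test functions: if `U`, `G_α(U)` are bounded on the slab, the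
iterated integral in `IsWeakSolution` is a single slab integral (Fubini).
[cite: Dafermos2000, §4.1 (4.1.6)] -/
theorem IsWeakSolution.slab_identity (hU : IsWeakSolution O G T U U₀)
    (hGm : ∀ α, AEStronglyMeasurable (fun p : ℝ × EuclideanSpace ℝ (Fin m) => G α (U p.1 p.2))
      (volume.restrict (slab m T)))
    {M : ℝ} (hUM : ∀ t ∈ Set.Ico 0 T, ∀ x, ‖U t x‖ ≤ M)
    (hGM : ∀ α, ∀ t ∈ Set.Ico 0 T, ∀ x, ‖G α (U t x)‖ ≤ M)
    {φ : ℝ × EuclideanSpace ℝ (Fin m) → ℝ} (hφ : IsTestFunction T φ) :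
    (∫ p in slab m T, (lineDeriv ℝ φ p (dirT m) • U p.1 p.2
        + ∑ α : Fin m, lineDeriv ℝ φ p (dirX α) • G α (U p.1 p.2)))
      + ∫ x, φ (0, x) • U₀ x = 0 := by
  have hid := hU.2.2.2.2.2.2 φ hφ
  have hφ1 : ContDiff ℝ 1 φ := hφ.1
  have hφc : HasCompactSupport φ := hφ.2.1
  -- the derivatives of `φ` are continuous with compact support
  have hdc : ∀ v, Continuous (fun p => lineDeriv ℝ φ p v) := fun v => by
    have : (fun p => lineDeriv ℝ φ p v) = fun p => fderiv ℝ φ p v := by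
      ext p; exact (hφ1.differentiable one_ne_zero p).lineDeriv_eq_fderiv
    rw [this]; exact (hφ1.continuous_fderiv one_ne_zero).clm_apply continuous_const
  have hds : ∀ v, HasCompactSupport (fun p => lineDeriv ℝ φ p v) := fun v => by
    have : (fun p => lineDeriv ℝ φ p v) = fun p => fderiv ℝ φ p v := by
      ext p; exact (hφ1.differentiable one_ne_zero p).lineDeriv_eq_fderiv
    rw [this]; exact hφc.fderiv_apply (𝕜 := ℝ) v
  have hUm : AEStronglyMeasurable (fun p : ℝ × EuclideanSpace ℝ (Fin m) => U p.1 p.2)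
      (volume.restrict (slab m T)) := hU.1.aestronglyMeasurable
  have hUM' : ∀ p ∈ slab m T, ‖U p.1 p.2‖ ≤ M := fun p hp =>
    hUM p.1 (Set.Ioo_subset_Ico_self (mem_slab.1 hp)) p.2
  have hGM' : ∀ α, ∀ p ∈ slab m T, ‖G α (U p.1 p.2)‖ ≤ M := fun α p hp =>
    hGM α p.1 (Set.Ioo_subset_Ico_self (mem_slab.1 hp)) p.2
  have hI1 : IntegrableOn (fun p : ℝ × EuclideanSpace ℝ (Fin m) =>
      lineDeriv ℝ φ p (dirT m) • U p.1 p.2) (slab m T) :=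
    integrableOn_slab_smul (hdc _) (hds _) hUm hUM'
  have hI2 : ∀ α, IntegrableOn (fun p : ℝ × EuclideanSpace ℝ (Fin m) =>
      lineDeriv ℝ φ p (dirX α) • G α (U p.1 p.2)) (slab m T) := fun α =>
    integrableOn_slab_smul (hdc _) (hds _) (hGm α) (hGM' α)
  have hI : IntegrableOn (fun p : ℝ × EuclideanSpace ℝ (Fin m) =>
      lineDeriv ℝ φ p (dirT m) • U p.1 p.2
        + ∑ α : Fin m, lineDeriv ℝ φ p (dirX α) • G α (U p.1 p.2)) (slab m T) :=
    hI1.add (integrable_finsetSum _ fun α _ => hI2 α)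
  rw [integral_slab_eq_iterated hI]
  simpa only [testTimeDeriv_eq_lineDeriv, testSpaceDeriv_eq_lineDeriv] using hid

end slabIdentity

/-! ### Mollification of Lipschitz functions (generic finite-dimensional space) -/

section bump

variable {E : Type*} [NormedAddCommGroup E] [NormedSpace ℝ E]

/-- A sequence of bump functions shrinking to the origin with bounded ratio `rOut / rIn = 2`
(radii `1/(2(k+1)) < 1/(k+1)`), the mollifiers of this file. [folklore] -/
def bumpSeq (E : Type*) [NormedAddCommGroup E] [NormedSpace ℝ E] (k : ℕ) : ContDiffBump (0 : E) where
  rIn := 1 / (2 * ((k : ℝ) + 1))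
  rOut := 1 / ((k : ℝ) + 1)
  rIn_pos := by positivity
  rIn_lt_rOut := by
    rw [one_div_lt_one_div (by positivity) (by positivity)]; linarith

/-- Outer radius of `bumpSeq k` is `1/(k+1)`. [folklore] -/
theorem bumpSeq_rOut (k : ℕ) : (bumpSeq E k).rOut = 1 / ((k : ℝ) + 1) := rfl

/-- Outer radius of `bumpSeq k` is at most `1`. [folklore] -/
theorem bumpSeq_rOut_le_one (k : ℕ) : (bumpSeq E k).rOut ≤ 1 := by
  rw [bumpSeq_rOut, div_le_one (by positivity)]; linarith [k.cast_nonneg (α := ℝ)]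

/-- The radii of `bumpSeq` tend to `0`. [folklore] -/
theorem tendsto_bumpSeq_rOut : Tendsto (fun k => (bumpSeq E k).rOut) atTop (𝓝 0) := by
  simp only [bumpSeq_rOut]
  exact tendsto_one_div_add_atTop_nhds_zero_nat

/-- Bounded ratio `rOut ≤ 2 rIn` for `bumpSeq` (hypothesis of the Lebesgue differentiation lemma
`ContDiffBump.ae_convolution_tendsto_right_of_locallyIntegrable`). [folklore] -/
theorem bumpSeq_rOut_le (k : ℕ) : (bumpSeq E k).rOut ≤ 2 * (bumpSeq E k).rIn := by
  apply le_of_eq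
  simp only [bumpSeq]
  field_simp

end bump

section mollify

variable {E : Type*} [NormedAddCommGroup E] [NormedSpace ℝ E] [FiniteDimensional ℝ E]
  [MeasurableSpace E] [BorelSpace E] {μ : Measure E} [μ.IsAddHaarMeasure]

/-- Sup bound for the mollification of a bounded function by a normed bump function. [folklore] -/
theorem norm_normed_convolution_le (ρ : ContDiffBump (0 : E)) {g : E → ℝ} {C : ℝ}
    (hg : ∀ x, ‖g x‖ ≤ C) (p : E) :
    ‖(ρ.normed μ ⋆[ContinuousLinearMap.lsmul ℝ ℝ, μ] g) p‖ ≤ C := by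
  rw [convolution_lsmul]
  have hC : 0 ≤ C := (norm_nonneg _).trans (hg p)
  calc ‖∫ y, ρ.normed μ y • g (p - y) ∂μ‖
      ≤ ∫ y, ρ.normed μ y * C ∂μ := by
        refine norm_integral_le_of_norm_le (ρ.integrable_normed.mul_const C) ?_
        refine Eventually.of_forall fun y => ?_
        rw [norm_smul, Real.norm_of_nonneg (ρ.nonneg_normed y)]
        exact mul_le_mul_of_nonneg_left (hg _) (ρ.nonneg_normed y)
    _ = C := by rw [integral_mul_const, ρ.integral_normed, one_mul]

/-- Evaluation of a convolution with values in linear forms (the `precompL` pairing produced by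
`HasCompactSupport.hasFDerivAt_convolution_left`); companion of Mathlib's `convolution_precompR_apply`.
[folklore] -/
theorem convolution_precompL_lsmul_apply {f : E → E →L[ℝ] ℝ} {g : E → ℝ}
    (hcf : HasCompactSupport f) (hf : Continuous f) (hg : LocallyIntegrable g μ) (x₀ v : E) :
    (f ⋆[ContinuousLinearMap.precompL E (ContinuousLinearMap.lsmul ℝ ℝ), μ] g) x₀ v
      = ∫ t, f t v * g (x₀ - t) ∂μ := by
  have := hcf.convolutionExists_left
    (ContinuousLinearMap.precompL E (ContinuousLinearMap.lsmul ℝ ℝ : ℝ →L[ℝ] ℝ →L[ℝ] ℝ) :) hf hg x₀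
  simp_rw [convolution_def, ContinuousLinearMap.integral_apply this]
  rfl

/-- **Derivative of a mollified Lipschitz function**: `D(ρ ⋆ Φ)(p) v = (ρ ⋆ ∂_vΦ)(p)`, where
`∂_vΦ = lineDeriv ℝ Φ · v` is the (a.e. defined, bounded) directional derivative; integration by
parts for Lipschitz functions (`LipschitzWith.integral_lineDeriv_mul_eq`). [folklore] -/
theorem fderiv_normed_convolution_apply (ρ : ContDiffBump (0 : E)) {Φ : E → ℝ} {K : ℝ≥0}
    (hΦ : LipschitzWith K Φ) (p v : E) :
    fderiv ℝ (ρ.normed μ ⋆[ContinuousLinearMap.lsmul ℝ ℝ, μ] Φ) p v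
      = (ρ.normed μ ⋆[ContinuousLinearMap.lsmul ℝ ℝ, μ] (fun q => lineDeriv ℝ Φ q v)) p := by
  have hρc : HasCompactSupport (ρ.normed μ) := ρ.hasCompactSupport_normed
  have hρd : ContDiff ℝ 1 (ρ.normed μ) := ρ.contDiff_normed
  have hΦli : LocallyIntegrable Φ μ := hΦ.continuous.locallyIntegrable
  have hD := (hρc.hasFDerivAt_convolution_left (ContinuousLinearMap.lsmul ℝ ℝ) hρd hΦli p).fderiv
  rw [hD, convolution_precompL_lsmul_apply (hρc.fderiv ℝ) (hρd.continuous_fderiv one_ne_zero)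
    hΦli p v, convolution_lsmul]
  -- integrate by parts
  obtain ⟨Kρ, hρL⟩ := hρd.lipschitzWith_of_hasCompactSupport hρc one_ne_zero
  have hf : LipschitzWith K (fun y => Φ (p - y)) := by
    have := hΦ.comp (IsometryEquiv.subLeft p).isometry.lipschitz
    simpa [Function.comp_def, mul_one] using this
  have key := LipschitzWith.integral_lineDeriv_mul_eq (μ := μ) hf hρL hρc v
  have e1 : ∀ y, lineDeriv ℝ (fun y => Φ (p - y)) y v = -lineDeriv ℝ Φ (p - y) v := by
    intro y
    rw [← lineDeriv_neg]
    unfold lineDeriv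
    congr 1; ext s
    simp only [smul_neg]; abel_nf
  have e2 : ∀ y, lineDeriv ℝ (ρ.normed μ) y (-v) = -fderiv ℝ (ρ.normed μ) y v := by
    intro y
    rw [lineDeriv_neg, (hρd.differentiable one_ne_zero y).lineDeriv_eq_fderiv]
  simp_rw [e1, e2] at key
  simp only [neg_mul, integral_neg, neg_inj] at key
  rw [← key]
  congr 1; ext y; rw [smul_eq_mul, mul_comm]

/-- The mollification of a `K`-Lipschitz function has directional derivatives bounded by `K‖v‖`.
[folklore] -/
theorem norm_fderiv_normed_convolution_apply_le (ρ : ContDiffBump (0 : E)) {Φ : E → ℝ} {K : ℝ≥0}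
    (hΦ : LipschitzWith K Φ) (p v : E) :
    ‖fderiv ℝ (ρ.normed μ ⋆[ContinuousLinearMap.lsmul ℝ ℝ, μ] Φ) p v‖ ≤ K * ‖v‖ := by
  rw [fderiv_normed_convolution_apply ρ hΦ p v]
  exact norm_normed_convolution_le ρ (fun q => norm_lineDeriv_le_of_lipschitz ℝ hΦ) p

/-- Mollifications (by a normed bump function) of continuous functions are smooth. [folklore] -/
theorem contDiff_normed_convolution (ρ : ContDiffBump (0 : E)) {Φ : E → ℝ} (hΦ : Continuous Φ) :
    ContDiff ℝ ∞ (ρ.normed μ ⋆[ContinuousLinearMap.lsmul ℝ ℝ, μ] Φ) :=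
  ρ.hasCompactSupport_normed.contDiff_convolution_left _ ρ.contDiff_normed hΦ.locallyIntegrable

/-- Support of a mollification: within `rOut` of the support of the mollified function. [folklore] -/
theorem tsupport_normed_convolution_subset (ρ : ContDiffBump (0 : E)) {Φ : E → ℝ} {R : ℝ}
    (hR : tsupport Φ ⊆ closedBall (0 : E) R) :
    tsupport (ρ.normed μ ⋆[ContinuousLinearMap.lsmul ℝ ℝ, μ] Φ) ⊆ closedBall (0 : E) (R + ρ.rOut) := by
  refine closure_minimal ?_ isClosed_closedBall
  intro p hp
  obtain ⟨a, ha, b, hb, rfl⟩ := support_convolution_subset _ hp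
  rw [ρ.support_normed_eq, mem_ball_zero_iff] at ha
  have hb' : ‖b‖ ≤ R := mem_closedBall_zero_iff.1 (hR (subset_tsupport _ hb))
  rw [mem_closedBall_zero_iff]
  calc ‖a + b‖ ≤ ‖a‖ + ‖b‖ := norm_add_le _ _
    _ ≤ ρ.rOut + R := add_le_add ha.le hb'
    _ = R + ρ.rOut := add_comm _ _

/-- **Lebesgue points**: along `bumpSeq`, the directional derivatives of the mollifications of a
Lipschitz `Φ` converge a.e. to the directional derivative of `Φ` (Lebesgue differentiation theorem
applied to the bounded measurable `∂_vΦ`). [folklore] -/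
theorem ae_tendsto_lineDeriv_normed_convolution {Φ : E → ℝ} {K : ℝ≥0} (hΦ : LipschitzWith K Φ)
    (v : E) :
    ∀ᵐ p ∂μ, Tendsto (fun k : ℕ =>
        lineDeriv ℝ ((bumpSeq E k).normed μ ⋆[ContinuousLinearMap.lsmul ℝ ℝ, μ] Φ) p v)
      atTop (𝓝 (lineDeriv ℝ Φ p v)) := by
  have h := ContDiffBump.ae_convolution_tendsto_right_of_locallyIntegrable (μ := μ)
    (φ := bumpSeq E) (l := atTop) (K := 2) tendsto_bumpSeq_rOut
    (Eventually.of_forall bumpSeq_rOut_le) (hΦ.locallyIntegrable_lineDeriv v)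
  filter_upwards [h] with p hp
  refine hp.congr fun k => ?_
  rw [← fderiv_normed_convolution_apply _ hΦ,
    ((contDiff_normed_convolution (bumpSeq E k) hΦ.continuous).differentiable
      (by simp)).differentiableAt.lineDeriv_eq_fderiv]

end mollify

/-! ### The weak identity for Lipschitz test functions -/

section lipschitzTest

variable {O : Set (EuclideanSpace ℝ (Fin n))}
  {G : Fin m → EuclideanSpace ℝ (Fin n) → EuclideanSpace ℝ (Fin n)} {T : ℝ}
  {U : ℝ → EuclideanSpace ℝ (Fin m) → EuclideanSpace ℝ (Fin n)}
  {U₀ : EuclideanSpace ℝ (Fin m) → EuclideanSpace ℝ (Fin n)}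

/-- **(4.1.6) with Lipschitz test functions** (Dafermos 2000, §4.1 p. 111: "for every Lipschitz
test function `φ` with compact support in `ℝ^m × [0,T)`").  If `U` is a weak solution on `[0,T)`
in the `C¹` sense of `IsWeakSolution`, with `U` and the fluxes `G_α(U)` bounded on the slab, then
for every Lipschitz `Φ` with compact support and `Φ = 0` for `t ≥ T'`, some `T' < T`,
`∫_{(0,T)×ℝ^m} [∂ₜΦ • U + ∑_α ∂_αΦ • G_α(U)] + ∫ Φ(0,x) • U₀(x) dx = 0`,
with `∂ₜΦ, ∂_αΦ` the line derivatives of `Φ` (defined a.e., Rademacher).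
[cite: Dafermos2000, §4.1 (4.1.6)] -/
theorem IsWeakSolution.lipschitz_test (hU : IsWeakSolution O G T U U₀)
    (hGm : ∀ α, AEStronglyMeasurable (fun p : ℝ × EuclideanSpace ℝ (Fin m) => G α (U p.1 p.2))
      (volume.restrict (slab m T)))
    (hGM : ∃ M, ∀ α, ∀ t ∈ Set.Ico 0 T, ∀ x, ‖G α (U t x)‖ ≤ M)
    {Φ : ℝ × EuclideanSpace ℝ (Fin m) → ℝ} {K : ℝ≥0} (hΦ : LipschitzWith K Φ)
    (hΦc : HasCompactSupport Φ) {T' : ℝ} (hT' : T' < T)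
    (hΦT : ∀ p : ℝ × EuclideanSpace ℝ (Fin m), T' ≤ p.1 → Φ p = 0) :
    (∫ p in slab m T, (lineDeriv ℝ Φ p (dirT m) • U p.1 p.2
        + ∑ α : Fin m, lineDeriv ℝ Φ p (dirX α) • G α (U p.1 p.2)))
      + ∫ x, Φ (0, x) • U₀ x = 0 := by
  classical
  haveI := isAddHaarMeasure_volume_spaceTime (m := m)
  -- bounds
  obtain ⟨M₁, hUM₁, hU₀M₁⟩ := hU.2.2.2.2.1
  obtain ⟨M₂, hGM₂⟩ := hGM
  set M : ℝ := max (max M₁ M₂) 0 with hMdef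
  have hM0 : 0 ≤ M := le_max_right _ _
  have hUM : ∀ t ∈ Set.Ico 0 T, ∀ x, ‖U t x‖ ≤ M := fun t ht x =>
    (hUM₁ t ht x).trans ((le_max_left _ _).trans (le_max_left _ _))
  have hU₀M : ∀ x, ‖U₀ x‖ ≤ M := fun x =>
    (hU₀M₁ x).trans ((le_max_left _ _).trans (le_max_left _ _))
  have hGM' : ∀ α, ∀ t ∈ Set.Ico 0 T, ∀ x, ‖G α (U t x)‖ ≤ M := fun α t ht x =>
    (hGM₂ α t ht x).trans ((le_max_right _ _).trans (le_max_left _ _))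
  obtain ⟨CΦ, hCΦ⟩ := hΦc.exists_bound_of_continuous hΦ.continuous
  obtain ⟨R, hR⟩ := hΦc.isCompact.isBounded.subset_closedBall 0
  -- the mollified test functions
  set ρ : ℕ → ContDiffBump (0 : ℝ × EuclideanSpace ℝ (Fin m)) :=
    bumpSeq (ℝ × EuclideanSpace ℝ (Fin m)) with hρ
  set Φk : ℕ → ℝ × EuclideanSpace ℝ (Fin m) → ℝ := fun k =>
    (ρ k).normed volume ⋆[ContinuousLinearMap.lsmul ℝ ℝ, volume] Φ with hΦk
  have hΦk_smooth : ∀ k, ContDiff ℝ ∞ (Φk k) := fun k =>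
    contDiff_normed_convolution (ρ k) hΦ.continuous
  have hΦk_diff : ∀ k, Differentiable ℝ (Φk k) := fun k =>
    (hΦk_smooth k).differentiable (by simp)
  have hΦk_supp : ∀ k, HasCompactSupport (Φk k) := fun k =>
    (ρ k).hasCompactSupport_normed.convolution _ hΦc
  have hΦk_tsupp : ∀ k, tsupport (Φk k) ⊆ closedBall 0 (R + 1) := fun k =>
    (tsupport_normed_convolution_subset (ρ k) hR).trans
      (closedBall_subset_closedBall (by linarith [bumpSeq_rOut_le_one (E := ℝ × EuclideanSpace ℝ (Fin m)) k]))
  have hΦk_T : ∀ k, ∀ p : ℝ × EuclideanSpace ℝ (Fin m), T' + (ρ k).rOut ≤ p.1 → Φk k p = 0 := by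
    intro k p hp
    simp only [hΦk, convolution_lsmul]
    refine integral_eq_zero_of_ae (Eventually.of_forall fun y => ?_)
    by_cases hy : y ∈ ball (0 : ℝ × EuclideanSpace ℝ (Fin m)) (ρ k).rOut
    · have hy1 : ‖y.1‖ < (ρ k).rOut := (norm_fst_le y).trans_lt (mem_ball_zero_iff.1 hy)
      have : T' ≤ (p - y).1 := by
        simp only [Prod.fst_sub]
        have := (abs_lt.1 (Real.norm_eq_abs y.1 ▸ hy1)).2
        linarith
      simp [hΦT _ this]
    · have : (ρ k).normed volume y = 0 := by
        rw [← notMem_support, (ρ k).support_normed_eq]; exact hy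
      simp [this]
  have hΦk_test : ∀ᶠ k in atTop, IsTestFunction T (Φk k) := by
    have : ∀ᶠ k in atTop, (ρ k).rOut < T - T' :=
      (tendsto_bumpSeq_rOut (E := ℝ × EuclideanSpace ℝ (Fin m))).eventually
        (gt_mem_nhds (by linarith))
    filter_upwards [this] with k hk
    exact ⟨(hΦk_smooth k).of_le (by simp), hΦk_supp k, T' + (ρ k).rOut, by linarith,
      fun t x ht => hΦk_T k (t, x) ht⟩
  -- derivative bounds and vanishing outside the big ball
  have hΦk_lineDeriv : ∀ k p v, lineDeriv ℝ (Φk k) p v = fderiv ℝ (Φk k) p v := fun k p v =>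
    (hΦk_diff k p).lineDeriv_eq_fderiv
  have hΦk_dbound : ∀ k p v, ‖lineDeriv ℝ (Φk k) p v‖ ≤ K * ‖v‖ := fun k p v => by
    rw [hΦk_lineDeriv]; exact norm_fderiv_normed_convolution_apply_le (ρ k) hΦ p v
  have hΦk_dzero : ∀ k p v, p ∉ closedBall (0 : ℝ × EuclideanSpace ℝ (Fin m)) (R + 1) →
      lineDeriv ℝ (Φk k) p v = 0 := fun k p v hp => by
    rw [hΦk_lineDeriv, fderiv_of_notMem_tsupport ℝ (fun h => hp (hΦk_tsupp k h))]
    rfl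
  have hΦ_dzero : ∀ p v, p ∉ closedBall (0 : ℝ × EuclideanSpace ℝ (Fin m)) (R + 1) →
      lineDeriv ℝ Φ p v = 0 := fun p v hp => by
    have hp' : p ∉ tsupport Φ := fun h => hp (closedBall_subset_closedBall (by linarith) (hR h))
    have : Φ =ᶠ[𝓝 p] 0 := notMem_tsupport_iff_eventuallyEq.1 hp'
    rw [Filter.EventuallyEq.lineDeriv_eq this]
    unfold lineDeriv; simp
  -- the identity for the mollified test functions
  set A : ℕ → EuclideanSpace ℝ (Fin n) := fun k => ∫ p in slab m T,
    (lineDeriv ℝ (Φk k) p (dirT m) • U p.1 p.2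
      + ∑ α : Fin m, lineDeriv ℝ (Φk k) p (dirX α) • G α (U p.1 p.2)) with hA
  set B : ℕ → EuclideanSpace ℝ (Fin n) := fun k => ∫ x, Φk k (0, x) • U₀ x with hB
  have hAB : ∀ᶠ k in atTop, A k + B k = 0 := by
    filter_upwards [hΦk_test] with k hk
    exact hU.slab_identity hGm hUM hGM' hk
  -- limit of `A k`: dominated convergence on the slab
  have hUm : AEStronglyMeasurable (fun p : ℝ × EuclideanSpace ℝ (Fin m) => U p.1 p.2)
      (volume.restrict (slab m T)) := hU.1.aestronglyMeasurable
  set bound : ℝ × EuclideanSpace ℝ (Fin m) → ℝ := (closedBall 0 (R + 1)).indicator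
    fun _ => K * ‖dirT m‖ * M + ∑ α : Fin m, K * ‖dirX α‖ * M with hbound
  have hA_lim : Tendsto A atTop (𝓝 (∫ p in slab m T, (lineDeriv ℝ Φ p (dirT m) • U p.1 p.2
      + ∑ α : Fin m, lineDeriv ℝ Φ p (dirX α) • G α (U p.1 p.2)))) := by
    refine tendsto_integral_of_dominated_convergence bound ?_ ?_ ?_ ?_
    · intro k
      have hc : ∀ v, Continuous fun p => lineDeriv ℝ (Φk k) p v := fun v => by
        simp_rw [hΦk_lineDeriv]
        exact ((hΦk_smooth k).continuous_fderiv (by simp)).clm_apply continuous_const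
      have h1 : AEStronglyMeasurable (fun p : ℝ × EuclideanSpace ℝ (Fin m) =>
          lineDeriv ℝ (Φk k) p (dirT m) • U p.1 p.2) (volume.restrict (slab m T)) :=
        (hc _).aestronglyMeasurable.smul hUm
      have h2 : ∀ α, AEStronglyMeasurable (fun p : ℝ × EuclideanSpace ℝ (Fin m) =>
          lineDeriv ℝ (Φk k) p (dirX α) • G α (U p.1 p.2)) (volume.restrict (slab m T)) :=
        fun α => (hc _).aestronglyMeasurable.smul (hGm α)
      exact h1.add (Finset.aestronglyMeasurable_fun_sum Finset.univ fun α _ => h2 α)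
    · rw [hbound, integrable_indicator_iff isClosed_closedBall.measurableSet]
      exact integrableOn_const (hs := ((Measure.restrict_apply_le _ _).trans_lt
        (isCompact_closedBall _ _).measure_lt_top).ne)
    · intro k
      rw [ae_restrict_iff' (measurableSet_slab T)]
      refine Eventually.of_forall fun p hp => ?_
      have hp' : p.1 ∈ Set.Ico 0 T := Set.Ioo_subset_Ico_self (mem_slab.1 hp)
      by_cases hpB : p ∈ closedBall (0 : ℝ × EuclideanSpace ℝ (Fin m)) (R + 1)
      · rw [hbound, indicator_of_mem hpB]
        refine (norm_add_le _ _).trans (add_le_add ?_ ((norm_sum_le _ _).trans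
          (Finset.sum_le_sum fun α _ => ?_)))
        · rw [norm_smul]
          exact mul_le_mul (hΦk_dbound k p _) (hUM p.1 hp' p.2) (norm_nonneg _) (by positivity)
        · rw [norm_smul]
          exact mul_le_mul (hΦk_dbound k p _) (hGM' α p.1 hp' p.2) (norm_nonneg _)
            (by positivity)
      · rw [hbound, indicator_of_notMem hpB]
        simp [hΦk_dzero k p _ hpB]
    · have hae : ∀ᵐ p ∂(volume : Measure (ℝ × EuclideanSpace ℝ (Fin m))),
          Tendsto (fun k => lineDeriv ℝ (Φk k) p (dirT m)) atTop (𝓝 (lineDeriv ℝ Φ p (dirT m)))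
          ∧ ∀ α, Tendsto (fun k => lineDeriv ℝ (Φk k) p (dirX α)) atTop
            (𝓝 (lineDeriv ℝ Φ p (dirX α))) := by
        refine (ae_tendsto_lineDeriv_normed_convolution hΦ (dirT m)).and ?_
        rw [ae_all_iff]
        exact fun α => ae_tendsto_lineDeriv_normed_convolution hΦ (dirX α)
      refine ae_restrict_of_ae ?_
      filter_upwards [hae] with p hp
      exact (hp.1.smul_const _).add (tendsto_finsetSum _ fun α _ => (hp.2 α).smul_const _)
  -- limit of `B k`: dominated convergence in space
  set bound₀ : EuclideanSpace ℝ (Fin m) → ℝ := (closedBall 0 (R + 1)).indicator fun _ => CΦ * M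
    with hbound₀
  have hB_lim : Tendsto B atTop (𝓝 (∫ x, Φ (0, x) • U₀ x)) := by
    refine tendsto_integral_of_dominated_convergence bound₀ ?_ ?_ ?_ ?_
    · intro k
      exact ((hΦk_smooth k).continuous.comp (Continuous.prodMk_right 0)).aestronglyMeasurable.smul
        hU.2.1.aestronglyMeasurable
    · rw [hbound₀, integrable_indicator_iff isClosed_closedBall.measurableSet]
      exact integrableOn_const (hs := (isCompact_closedBall _ _).measure_lt_top.ne)
    · intro k
      refine Eventually.of_forall fun x => ?_
      by_cases hx : x ∈ closedBall (0 : EuclideanSpace ℝ (Fin m)) (R + 1)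
      · rw [hbound₀, indicator_of_mem hx, norm_smul]
        exact mul_le_mul (norm_normed_convolution_le (ρ k) hCΦ _) (hU₀M x) (norm_nonneg _)
          ((norm_nonneg _).trans (hCΦ 0))
      · have hx' : ((0 : ℝ), x) ∉ closedBall (0 : ℝ × EuclideanSpace ℝ (Fin m)) (R + 1) := by
          intro h; apply hx
          rw [mem_closedBall_zero_iff] at h ⊢
          exact (norm_snd_le ((0 : ℝ), x)).trans h
        have : Φk k (0, x) = 0 := image_eq_zero_of_notMem_tsupport fun h => hx' (hΦk_tsupp k h)
        rw [hbound₀, indicator_of_notMem hx, this, zero_smul, norm_zero]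
    · refine Eventually.of_forall fun x => ?_
      exact (ContDiffBump.convolution_tendsto_right_of_continuous
        (tendsto_bumpSeq_rOut (E := ℝ × EuclideanSpace ℝ (Fin m))) hΦ.continuous (0, x)).smul_const _
  -- conclusion
  have hlim := hA_lim.add hB_lim
  have hzero : Tendsto (fun k => A k + B k) atTop (𝓝 0) :=
    tendsto_const_nhds.congr' (hAB.mono fun k hk => hk.symm)
  exact tendsto_nhds_unique hlim hzero

end lipschitzTest



end ConservationLaw

end Literature.Analysis.PDE
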